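import Summits.CriticalPhenomena.PercolationContinuityZ3.Theorems.SoloBlindKNUniformCoefficients
import Summits.CriticalPhenomena.PercolationContinuityZ3.Theorems.PercNearOneGluingNoHeavyLowerTailKNConj4AllWeights
import HarnessLib

/-!
# `NoHeavyLowerTail` (stmt-CriticalPhenomena-4575) — the `SoloBlindKN` statements `KNConj4Real`, `KNUniformUpsets`, `KNQuestion5Strong`,
# `KNQuestion5`, `KNConj2All` HOLD at every `(G, A ≠ ∅, 0)` on `Fin n`

Support file (`--supports stmt-CriticalPhenomena-4575`), prover `prim-ineq-gen-7` (gen 7).  No definitions, no named facts, no sorries; standard axioms.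

`SoloBlindKNUniformCoefficients.lean` / `SoloBlindKNLayerCake.lean` (solo seat) recorded — CONDITIONALLY, when Kozma–Nitzan's Conjecture 4 was a hypothesis —
that Conjecture 4 at `(G, A, 0)` is equivalent to the existence of ONE probability vector of coefficients serving every up-set (`knConj4Real_iff_uniformUpsets`,
LP duality via the tree's Farkas lemma) and hence answers Question 5 (`knQuestion5_of_conj4Real`).  Conjecture 4 is now a tree theorem for every finite
weighted graph (`PreFKGSurplus.kn_conj4`, prim-ineq-gen-6 / prim-hp-8's CSH chain; independently re-derived unconditional coefficient theorems:
`UniversalGluing.universal_coefficients`, `UniversalGluing.kn_question5`, this seat).  This file DISCHARGES the solo seat's named statements on the vertex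
type `Fin n`: the bridge is the identity between their finite-sum expectation `clusterExp w A o F x = Σ_S F(S)·μ(C_x = S, o ↔ A)` and the set integral
`∫_{o↔A} F(C_x) dμ` (`SoloBlindKN.clusterExp_eq_setIntegral`).
[cite: KozmaNitzan2024, Conj. 4 and Question 5 (p. 32), Conj. 2 (p. 3)]
-/

noncomputable section

namespace Summit.CriticalPhenomena.PercolationContinuityZ3.Theorems

open MeasureTheory Set Literature.Probability.LatticeModels Literature.Probability.Percolation
open scoped Classical

namespace SoloBlindKN

variable {n : ℕ}

/-- `connTo o A` is the union event `⋃_{a∈A} {o ↔ a}`. [folklore] -/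
theorem connTo_eq_iUnion (o : Fin n) (A : Finset (Fin n)) :
    connTo o A = ⋃ a ∈ A, (openConn o a : Set (BondConfig (Fin n))) := rfl

/-- **The finite-sum expectation is the set integral**: `clusterExp w A o F x = ∫_{o ↔ A} F(C_x) dμ`. [folklore] -/
theorem clusterExp_eq_setIntegral (w : Sym2 (Fin n) → unitInterval) (A : Finset (Fin n)) (o : Fin n) (F : Set (Fin n) → ℝ) (x : Fin n) :
    clusterExp w A o F x = ∫ ω in connTo o A, F (openCluster ω x) ∂(prodBernoulli w) := by
  set μ := prodBernoulli w with hμ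
  have hint : ∀ (g : BondConfig (Fin n) → ℝ), Integrable g (μ.restrict (connTo o A)) := fun g => Integrable.of_finite
  -- pointwise: `F(C_x(ω)) = Σ_S F(S)·1{C_x(ω) = S}`
  have hpt : (fun ω : BondConfig (Fin n) => F (openCluster ω x)) =
      fun ω => ∑ S : Set (Fin n), F S * ({η : BondConfig (Fin n) | openCluster η x = S} : Set (BondConfig (Fin n))).indicator 1 ω := by
    funext ω
    rw [Finset.sum_eq_single (openCluster ω x)]
    · rw [indicator_of_mem (show ω ∈ {η : BondConfig (Fin n) | openCluster η x = openCluster ω x} from rfl), Pi.one_apply, mul_one]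
    · intro S _ hS
      rw [indicator_of_notMem (show ω ∉ {η : BondConfig (Fin n) | openCluster η x = S} from fun h => hS h.symm), mul_zero]
    · intro h; exact absurd (Finset.mem_univ _) h
  rw [hpt, integral_finsetSum _ fun S _ => hint _]
  unfold clusterExp clusterPM
  refine Finset.sum_congr rfl fun S _ => ?_
  rw [integral_const_mul, KNPreFKG.setIntegral_indicator_one_eq, inter_comm]

/-- **Kozma–Nitzan's Conjecture 4 at every `(G, A ≠ ∅, 0)` on `Fin n`, in the solo seat's vocabulary** (`KNConj4Real`), from `PreFKGSurplus.kn_conj4`.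
[cite: KozmaNitzan2024, Conj. 4 (p. 32)] -/
theorem knConj4Real_holds (w : Sym2 (Fin n) → unitInterval) (A : Finset (Fin n)) (o : Fin n) (hA : A.Nonempty) : KNConj4Real w A o := by
  intro F hF
  obtain ⟨a, ha, hle⟩ := PreFKGSurplus.kn_conj4 w A o F (fun S T hST => hF hST) hA
  refine ⟨a, ha, ?_⟩
  rw [clusterExp_eq_setIntegral, clusterExp_eq_setIntegral, connTo_eq_iUnion]
  exact hle

/-- **Uniform (F-independent) coefficients exist at every `(G, A ≠ ∅, 0)`** (`KNUniformUpsets`). [cite: KozmaNitzan2024, Conj. 4 and Question 5 (p. 32)] -/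
theorem knUniformUpsets_holds (w : Sym2 (Fin n) → unitInterval) (A : Finset (Fin n)) (o : Fin n) (hA : A.Nonempty) : KNUniformUpsets w A o :=
  knUniformUpsets_of_conj4Real w A o (knConj4Real_holds w A o hA)

/-- **Question 5, strong form, at every `(G, A ≠ ∅, 0)`** (`KNQuestion5Strong`). [cite: KozmaNitzan2024, Question 5 (p. 32)] -/
theorem knQuestion5Strong_holds (w : Sym2 (Fin n) → unitInterval) (A : Finset (Fin n)) (o : Fin n) (hA : A.Nonempty) : KNQuestion5Strong w A o :=
  knQuestion5Strong_of_uniformUpsets w A o (knUniformUpsets_holds w A o hA)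

/-- **KOZMA–NITZAN'S QUESTION 5 — YES — at every `(G, A ≠ ∅, 0)` on `Fin n`** (`KNQuestion5`, display (38)). [cite: KozmaNitzan2024, Question 5 (p. 32)] -/
theorem knQuestion5_holds (w : Sym2 (Fin n) → unitInterval) (A : Finset (Fin n)) (o : Fin n) (hA : A.Nonempty) : KNQuestion5 w A o :=
  knQuestion5_of_conj4Real w A o (knConj4Real_holds w A o hA)

/-- **Conjecture 2 for every `b` at every `(G, A ≠ ∅, 0)`** (`KNConj2All`). [cite: KozmaNitzan2024, Conj. 2 (p. 3)] -/
theorem knConj2All_holds (w : Sym2 (Fin n) → unitInterval) (A : Finset (Fin n)) (o : Fin n) (hA : A.Nonempty) : KNConj2All w A o :=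
  knConj2All_of_conj4Real w A o (knConj4Real_holds w A o hA)

end SoloBlindKN

end Summit.CriticalPhenomena.PercolationContinuityZ3.Theorems

end
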